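import Summits.QuantumFields.YangMills.Theorems.UnitScaleTiltProp7GreenOneGradientFamilyAllMembers
import Summits.QuantumFields.YangMills.Theorems.UnitScaleTiltProp7NormHpiFamilyPackage
import Summits.QuantumFields.YangMills.Theorems.UnitScaleTiltProp7KinvOneFamilyPackageAllMembers
import Summits.QuantumFields.YangMills.Theorems.UnitScaleTiltProp7H1OneFamilyPackageAllMembers
import Summits.QuantumFields.YangMills.Theorems.UnitScaleTiltProp7TJSlotCoerciveClosedAllMembers
import Summits.QuantumFields.YangMills.Theorems.UnitScaleTiltProp7HTValueRowOfKernel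
import Summits.QuantumFields.YangMills.Theorems.UnitScaleTiltProp7SectET3DeltaOneT3PInvGlue
import HarnessLib

/-!
# Route `UnitScaleTilt`, crux K1 «MinimiserStabilityRegPr» (stmt-QuantumFields-19200), EX row (6) `norm_H₁` — NORM-H₁-PKG-R = O2 part 2∕2, R-EDITION (NO ROOM): **THE S47 ROW `norm_H₁` FOR ALL MEMBERS AS ONE
# `∃`-PACKAGE, MODULO px19's `hqG`, ROOM-FREE** (generated from ✓`Prop7NormHoneFamilyPackage` by `gen/gen_oR.py`: the ROOM antecedent deleted, suppliers ↦ their `_allMembers`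
# editions (∇1)-FAM-R, T3-R, K6-Δ₁-R, H1-R; NO other token of the statements touched) — the `Δ₁ᴾ(T_Jᴾ)`-slot twin of px21 g16's ✓∕⧗`Prop7NormHpiFamilyPackage` (row (2)), by the same two doors: `hGone_family_exists` = the H-door's
# gradient letter (px21 ✓`Prop7GreenPiGradientRowOfLetters.gradient_row_HT_of_gradient_row`, slot-generic) at the J-slot of every member over part 1 ✓∕⧗`Prop7GreenOneGradientFamily.gradient_GTone_family_exists`
# ((∇1) row), the `Q_k†` sup row (px21 ✓∕⧗`Prop7NormHpiFamilyPackage.qdag_supRow_member`, `∝ (cB∕c₀)ℓ⁻³`) and px12 g18's K6-Δ₁ ✓`Prop7KinvOneFamilyPackage.kinvRow_one_family_exists` read as a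
# sup row by this lineage's ✓`Prop7KinvSupRowOfKernelRow.supRow_KinvT_of_kernelRow` (`∝ (c₀∕cB)ℓ³`; the product is L-ONLY); and `normHone_family_exists` = px21's member door
# ✓`Prop7HTValueRowOfKernel.norm_H1f_le_of_kernelRow_of_gradLetter` over px12's K6-H1 ✓`Prop7H1OneFamilyPackage.hH1kernel_family_exists` (the VALUE half: kernel row of `H₁`) and
# `hGone_family_exists` ⟹ S47's `norm_H₁` ROW TEXT at EVERY member under `RegPr ∧ cap ∧ Lift ∧ ROOM ∧ coupling window`, DISPLAYING `hqG` (the one open input of the J-slot road,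
# px12 g18 15:58:49Z) — the row (6) socket.  (★★OWNER g36 ■ FINAL NOTICE (1), pen O2 «row (6) ∇-half at Δ₁ by generator»; width seat `ym3-torus-px17` g13.)

Cell `ym3-torus` (HUMAN RULING D-0037; rung R3 = SU(2) YM₃ on T³ — NOT d = 4, NOT infinite volume, NOT a mass gap, NOT Clay).  THEOREMS ONLY (0 `def`, 0 `sorry`, default heartbeats);
`--supports stmt-QuantumFields-19200 --as helper`; count-neutral.

WHAT IS PROVED (ns `Summit.QuantumFields.YangMills.Theorems.Prop7NormHoneFamilyPackageAllMembers`).  For positive L-only weights `c₀ cB : ℕ → ℝ`, a coupling window `0 < a₀ ≤ a₁` and px19's `hqG`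
letter (`αq qG hαq hqG hqGrow`, T1∕K6-Δ₁∕K6-H1's binder VERBATIM):
* §1 ★★★ `hGone_family_exists_allMembers` — `∃ αM MG : ℕ → ℝ` (cap with the three windows of record, `αM ≤ αq`, `αM ≤ 1`, `0 ≤ MG`) such that for every `L > 1`, `i : Idx L`, `U₀` with `RegPr ρ U₀`,
  `ρ ≤ αM L`, under `Lift` (NO ROOM), every coupling in the window: N1-H's `hG` TEXT at the J-slot `∀ b, ‖nabla115 ((L⁻¹)^(K−n)) (bgOfCfg U₀) (fun q => toL2⁻¹(H₁(toL2B b)) (bondEquiv⁻¹ q))‖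
  ≤ MG L * ‖b‖`, `H₁ = HT … a (DeltaOneP … a (TJSlotP … a)) U₀` — census row (6)'s ∇-HALF for every member, L-only ([Balaban1985BackgroundPropagators] (3.138)∕Thm 3.13 for (3.129)).
* §2 ★★★ `normHone_family_exists_allMembers` — `∃ αN B₀ : ℕ → ℝ` (same caps) with, per member under the same antecedents, **S47's `norm_H₁` ROW TEXT at the printed J-slot**
  `∀ b, ‖H1f … a (DeltaOnePJ … a) U₀ b‖ ≤ B₀ L * ‖b‖` — S47 :205–214 VERBATIM modulo `a L i ↦ a` (as px21's row (2); `DeltaOnePJ … a = DeltaOneP … a (TJSlotP … a)` is ✓`DeltaOnePJ_def`, `rfl`, used once inside),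
  `B₀ L := max (3·CH L·(2(1+1∕(δH L∕2)))³) (MG L)` ([Balaban1985BackgroundPropagators] Thm 3.13 for `H₁` (3.129)∕[Balaban1985Variational] (117)).
HYP-SAT (★★OWNER RULING №42).  Displayed: `RegPr`∕cap∕`Lift`∕coupling window (classes of record; NO ROOM) and `hqG` (a real inequality between displayed terms, inhabited at `U₀ = 1`; chair: disprover-first on FR₂-lite); constants EXISTENTIAL-but-L-only; conclusions
non-vacuous; no `Prop` placeholder.
HONEST SCOPE.  An `∃`-assembly over landed packages (no estimate proved here); nothing of `hqG`, rows (1)–(5)(7)(8), `hThm2S`, EX `stub_existenceMinimalOrbit`, 19200 or the rung is proved;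
no summit is proved by a helper; the Yang–Mills mass gap is NOT proved.

References: T. Bałaban, CMP **99** (1985) 389–434 [Balaban1985BackgroundPropagators] ((3.16) p.393, (3.126)–(3.129) pp.420–421, (3.134)–(3.138) pp.422–423, Thm 3.13 p.426);
CMP **102** (1985) 277–309 [Balaban1985Variational] (Thm 1 p.279, (44)–(46) p.285, (103) p.293, (110)–(111) p.294, (115)–(117) pp.294–295).
-/

set_option autoImplicit false

noncomputable section

open scoped Matrix.Norms.L2Operator BigOperators InnerProductSpace ComplexConjugate

namespace Summit.QuantumFields.YangMills.Theorems.Prop7NormHoneFamilyPackageAllMembers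

open Literature.MathematicalPhysics.QuantumFieldTheory.Balaban1983to89
open Literature.MathematicalPhysics.QuantumFieldTheory.Balaban1983to89.T3ContinuumYM3Torus
open Literature.MathematicalPhysics.QuantumFieldTheory.Balaban1983to89.T3Thm1Carrier (Idx)
open Literature.MathematicalPhysics.QuantumFieldTheory.Balaban1983to89.T3PrintedRegularMinimiser (RegPr)
open Literature.MathematicalPhysics.QuantumFieldTheory.Balaban1983to89.T3PrintedMinimiserExistence (regPr_mono)
open T3LevelShift (siteShift)
open T3PrintedRegularOrbits (sites_eq)
open B15DeterminingSets (embIter)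
open T3SectALandauChart (bgUnits)
open B9SectCLatticeCarrier (Bond)
open B9Eq311L2Pairing (WL2)
open B11Eq90V0primeCurrent (flat115)
open B11Eq111FrakG (nabla115)
open B11Eq103H1Complex (SiteL2K BondL2K)
open B5Eq118OneStroke (iterBlockOf)
open Summit.QuantumFields.YangMills.Theorems.Prop8Chart (emlIterU)
open Summit.QuantumFields.YangMills.Theorems.Prop7SectET3Transport (periodsT3 bondEquiv bgOfCfg)
open Summit.QuantumFields.YangMills.Theorems.Prop7SectET3HilbertLetters (W₂ toL2 toL2S toL2B DL2 DstarL2)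
open Summit.QuantumFields.YangMills.Theorems.Prop7SectET3CurvedPropagators (Qk GT PosOnto HT H1f KinvT)
open Summit.QuantumFields.YangMills.Theorems.Prop7SectET3DeltaOne (avgHess)
open Summit.QuantumFields.YangMills.Theorems.Prop7SectET3DeltaOnePInv (DeltaOneP TJSlotP DeltaOnePJ DeltaOnePJ_def)
open Summit.QuantumFields.YangMills.Theorems.Prop7TJSlotCoerciveClosedAllMembers (hco_DeltaOnePJ_exists_allMembers)
open Summit.QuantumFields.YangMills.Theorems.Prop7GreenOneGradientFamilyAllMembers (gradient_GTone_family_exists_allMembers)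
open Summit.QuantumFields.YangMills.Theorems.Prop7GreenPiGradientRowOfLetters (gradient_row_HT_of_gradient_row)
open Summit.QuantumFields.YangMills.Theorems.Prop7NormHpiFamilyPackage (qdag_supRow_member)
open Summit.QuantumFields.YangMills.Theorems.Prop7KinvSupRowOfKernelRow (supRow_KinvT_of_kernelRow)
open Summit.QuantumFields.YangMills.Theorems.Prop7KinvOneFamilyPackageAllMembers (kinvRow_one_family_exists_allMembers)
open Summit.QuantumFields.YangMills.Theorems.Prop7H1OneFamilyPackageAllMembers (hH1kernel_family_exists_allMembers)
open Summit.QuantumFields.YangMills.Theorems.Prop7Kernel133DoorOfKinvRow (flat115_H1f_apply)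
open Summit.QuantumFields.YangMills.Theorems.Prop7HTValueRowOfKernel (norm_H1f_le_of_kernelRow_of_gradLetter)

variable [hFL : ∀ F : T3Family, Fact (0 < (F.L : ℝ))] [hFη : ∀ (F : T3Family) (k : ℕ), Fact (0 < ((F.L : ℝ)⁻¹) ^ k)]

/-! ## §1 ★★★ N1-H's gradient letter `hG` at the J-slot for all members, modulo `hqG` -/

/-- ★★★ **THE GRADIENT LETTER OF `H₁` AT THE J-SLOT FOR ALL MEMBERS — NO ROOM — L-ONLY CONSTANTS, MODULO `hqG`** (R-edition of ✓`hGone_family_exists`: the ROOM antecedent deleted, suppliers ↦ `_allMembers`) — ✓`gradient_row_HT_of_gradient_row` at `Δx := Δ₁ᴾ(T_Jᴾ)` of every member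
over part 1's (∇1) family, px21's `Q_k†` member row and px12's K6-Δ₁ kernel row read as a sup row (✓`supRow_KinvT_of_kernelRow`); the product of the two K-storey constants is L-only
(`(cB∕c₀)ℓ⁻³·(c₀∕cB)ℓ³ = 1`).
[cite: Balaban1985BackgroundPropagators, (3.126)–(3.129) pp.420–421, (3.134)–(3.138) pp.422–423, Thm 3.13 p.426; Balaban1985Variational, Thm 1 p.279, (45)–(46) p.285, (110)–(111) p.294, (115)–(117) pp.294–295] -/
theorem hGone_family_exists_allMembers (c₀ cB : ℕ → ℝ) [hc₀ : ∀ L : ℕ, Fact (0 < c₀ L)] [hcB : ∀ L : ℕ, Fact (0 < cB L)] {a₀ a₁ : ℝ} (ha₀ : 0 < a₀) (ha₀₁ : a₀ ≤ a₁)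
    (αq qG : ℕ → ℝ) (hαq : ∀ L : ℕ, 1 < L → 0 < αq L) (hqG : ∀ L : ℕ, 1 < L → 0 ≤ qG L)
    (hqGrow : ∀ (L : ℕ), 1 < L → ∀ (i : Idx L) (U₀ : GaugeField (i.1.1.P i.1.2.2) 0 (Matrix.specialUnitaryGroup (Fin 2) ℂ)), RegPr i.1.1 i.1.2.1 i.1.2.2 (αq L) U₀ →
      ∀ (X' : PBond (i.1.1.P i.1.2.2) 0 → Matrix (Fin 2) (Fin 2) ℂ) (s : ℝ) (x : Site (i.1.1.P i.1.2.2) 0) (A : Matrix (Fin 2) (Fin 2) ℂ), (∀ b, ‖X' b‖ ≤ s) →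
        ∑ y : PBond (i.1.1.P i.1.2.1) 0, ‖avgHess i.1.1 i.1.2.1 i.1.2.2 i.2.2.le U₀ X'
            ((toL2 i.1.1 i.1.2.2 (c₀ L)).symm (DL2 i.1.1 i.1.2.1 i.1.2.2 (c₀ L) U₀ (toL2S i.1.1 i.1.2.2 (c₀ L) (Pi.single x A)))) y‖
          ≤ qG L * ((L : ℝ) ^ (i.1.2.2 - i.1.2.1))⁻¹ * s * ‖A‖) :
    ∃ (αM MG : ℕ → ℝ),
      (∀ L : ℕ, 1 < L → 0 < αM L) ∧ (∀ L : ℕ, 1 < L → 10 ^ 12 * (L : ℝ) ^ 3 * αM L ≤ 1) ∧ (∀ L : ℕ, 1 < L → 10 ^ 10 * (L : ℝ) ^ 6 * αM L ≤ 1) ∧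
      (∀ L : ℕ, 1 < L → 13 * 10 ^ 14 * (L : ℝ) ^ 3 * αM L ≤ 1) ∧ (∀ L : ℕ, 1 < L → αM L ≤ αq L) ∧ (∀ L : ℕ, 1 < L → αM L ≤ 1) ∧ (∀ L : ℕ, 1 < L → 0 ≤ MG L) ∧
    ∀ (L : ℕ), 1 < L → ∀ (i : Idx L) (U₀ : GaugeField (i.1.1.P i.1.2.2) 0 (Matrix.specialUnitaryGroup (Fin 2) ℂ)), ∀ ρ : ℝ, RegPr i.1.1 i.1.2.1 i.1.2.2 ρ U₀ → ρ ≤ αM L →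
        (∀ cf : Site (i.1.1.P i.1.2.2) (i.1.2.2 - i.1.2.1) → Matrix (Fin 2) (Fin 2) ℂ,
        (∀ e' : PBond (i.1.1.P i.1.2.2) (i.1.2.2 - i.1.2.1), cf e'.src = ((emlIterU (i.1.2.2 - i.1.2.1) (bgUnits i.1.1 i.1.2.2 U₀) e' : (Matrix (Fin 2) (Fin 2) ℂ)ˣ) : Matrix (Fin 2) (Fin 2) ℂ) * cf e'.tgt *
        (((emlIterU (i.1.2.2 - i.1.2.1) (bgUnits i.1.1 i.1.2.2 U₀) e')⁻¹ : (Matrix (Fin 2) (Fin 2) ℂ)ˣ) : Matrix (Fin 2) (Fin 2) ℂ)) →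
        ∃ l₀ : Site (i.1.1.P i.1.2.2) 0 → Matrix (Fin 2) (Fin 2) ℂ,
        (∀ b' : PBond (i.1.1.P i.1.2.2) 0, l₀ b'.src = ((bgUnits i.1.1 i.1.2.2 U₀ b' : (Matrix (Fin 2) (Fin 2) ℂ)ˣ) : Matrix (Fin 2) (Fin 2) ℂ) * l₀ b'.tgt * (((bgUnits i.1.1 i.1.2.2 U₀ b')⁻¹ : (Matrix (Fin 2) (Fin 2) ℂ)ˣ) : Matrix (Fin 2) (Fin 2) ℂ)) ∧
        ∀ y : Site (i.1.1.P i.1.2.2) (i.1.2.2 - i.1.2.1), l₀ (embIter (i.1.2.2 - i.1.2.1) y) = cf y) →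
      ∀ a : ℝ, a₀ * (c₀ L / cB L) * ((i.1.1.L : ℝ) ^ (i.1.2.2 - i.1.2.1)) ^ 3 ≤ a → a ≤ a₁ * (c₀ L / cB L) * ((i.1.1.L : ℝ) ^ (i.1.2.2 - i.1.2.1)) ^ 3 →
      ∀ b : PBond (i.1.1.P i.1.2.1) 0 → Matrix (Fin 2) (Fin 2) ℂ,
        ‖nabla115 (((i.1.1.L : ℝ)⁻¹) ^ (i.1.2.2 - i.1.2.1)) (bgOfCfg i.1.1 i.1.2.2 U₀)
            (fun q : Bond 3 (periodsT3 i.1.1 i.1.2.2) => (toL2 i.1.1 i.1.2.2 (c₀ L)).symm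
              (HT i.1.1 i.1.2.1 i.1.2.2 i.2.2.le (c₀ L) (cB L) a
                (DeltaOneP i.1.1 i.1.2.1 i.1.2.2 i.2.2.le (c₀ L) (cB L) a (TJSlotP i.1.1 i.1.2.1 i.1.2.2 i.2.2.le (c₀ L) (cB L) a)) U₀ (toL2B i.1.1 i.1.2.1 (cB L) b))
              ((bondEquiv i.1.1 i.1.2.2).symm q))‖ ≤ MG L * ‖b‖ := by
  classical
  obtain ⟨αG, BG₁, hαG, hWG12, hWG10, hWG13, hαGq, hαG1, hBG₁, hGrow⟩ := gradient_GTone_family_exists_allMembers c₀ cB ha₀ ha₀₁ αq qG hαq hqG hqGrow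
  obtain ⟨αPi, CPi, μPi, hαPi, hWPi12, hWPi10, hWPi13, hαPi1, hCPi, hμPi, hK1⟩ := kinvRow_one_family_exists_allMembers c₀ cB ha₀ ha₀₁ αq qG hαq hqG hqGrow
  obtain ⟨αcJ, γcJ, hαcJ, hWcJ, hwincJ, hγcJ, hcoJ⟩ := hco_DeltaOnePJ_exists_allMembers c₀ cB ha₀ ha₀₁
  set αM : ℕ → ℝ := fun L => min (αG L) (min (αPi L) (αcJ L)) with hαM
  have hαM0 : ∀ L : ℕ, 1 < L → 0 < αM L := fun L hL => by
    have := hαG L hL; have := hαPi L hL; have := hαcJ L hL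
    simp only [hαM]; exact lt_min (by assumption) (lt_min (by assumption) (by assumption))
  have hαMG : ∀ L, αM L ≤ αG L := fun L => min_le_left _ _
  have hαMPi : ∀ L, αM L ≤ αPi L := fun L => (min_le_right _ _).trans (min_le_left _ _)
  have hαMcJ : ∀ L, αM L ≤ αcJ L := fun L => (min_le_right _ _).trans (min_le_right _ _)
  refine ⟨αM, fun L => BG₁ L * (3 * (2 * (Real.sqrt 2 * (2 * Real.exp ((159 * ((((3 : ℕ) + 2) * L : ℕ) : ℝ) * (2 * ((3 : ℕ) : ℝ))) / (((L : ℝ) ^ (3 : ℕ))⁻¹ * (L : ℝ)) * (((((3 : ℕ) + 2) * L : ℕ) : ℝ) ^ 2 / 16 * αM L)) + 1))) * CPi L * (2 * (1 + 1 / μPi L)) ^ 3),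
    hαM0, fun L hL => ?_, fun L hL => ?_, fun L hL => ?_, fun L hL => (hαMG L).trans (hαGq L hL), fun L hL => (hαMG L).trans (hαG1 L hL), fun L hL => ?_, ?_⟩
  · exact (mul_le_mul_of_nonneg_left (hαMG L) (by positivity)).trans (hWG12 L hL)
  · exact (mul_le_mul_of_nonneg_left (hαMG L) (by positivity)).trans (hWG10 L hL)
  · exact (mul_le_mul_of_nonneg_left (hαMG L) (by positivity)).trans (hWG13 L hL)
  · have := hBG₁ L hL; have := hCPi L hL; have := hμPi L hL; have := (hαM0 L hL).le
    positivity
  -- the member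
  intro L hL i U₀ ρ hreg hρ hlift a ha₀a ha₁a b
  have hc₀L : 0 < c₀ L := (hc₀ L).out
  have hcBL : 0 < cB L := (hcB L).out
  have hL0 : (0 : ℝ) < L := by exact_mod_cast lt_trans zero_lt_one hL
  have hLL : (L : ℝ) = (i.1.1.L : ℝ) := by rw [i.2.1]
  have hαL := hαM0 L hL
  have ha : 0 ≤ a := le_trans (by positivity) ha₀a
  have hregM : RegPr i.1.1 i.1.2.1 i.1.2.2 (αM L) U₀ := regPr_mono i.1.1 hρ hreg
  have hW10 : 10 ^ 10 * (L : ℝ) ^ 6 * αM L ≤ 1 := (mul_le_mul_of_nonneg_left (hαMG L) (by positivity)).trans (hWG10 L hL)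
  have hW12 : 10 ^ 12 * (L : ℝ) ^ 3 * αM L ≤ 1 := (mul_le_mul_of_nonneg_left (hαMG L) (by positivity)).trans (hWG12 L hL)
  -- PosOnto at the J-slot
  have hp₁ : PosOnto i.1.1 i.1.2.1 i.1.2.2 i.2.2.le (c₀ L) (cB L) a
      (DeltaOneP i.1.1 i.1.2.1 i.1.2.2 i.2.2.le (c₀ L) (cB L) a (TJSlotP i.1.1 i.1.2.1 i.1.2.2 i.2.2.le (c₀ L) (cB L) a)) U₀ :=
    (hcoJ L hL i U₀ ρ hreg (hρ.trans (hαMcJ L)) hlift a ha₀a ha₁a).2.1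
  -- the three letters
  have hG := hGrow L hL i U₀ ρ hreg (hρ.trans (hαMG L)) hlift a ha₀a ha₁a
  have hQ := qdag_supRow_member c₀ cB L i hαL hW10 hW12 U₀ hregM
  have hCK0 : 0 ≤ CPi L * ((c₀ L / cB L) * ((L : ℝ) ^ (i.1.2.2 - i.1.2.1)) ^ 3) := mul_nonneg (hCPi L hL) (by positivity)
  have hK := supRow_KinvT_of_kernelRow i.1.1 i.1.2.1 i.1.2.2 i.2.2.le (c₀ L) (cB L) a
    (DeltaOneP i.1.1 i.1.2.1 i.1.2.2 i.2.2.le (c₀ L) (cB L) a (TJSlotP i.1.1 i.1.2.1 i.1.2.2 i.2.2.le (c₀ L) (cB L) a)) U₀ hCK0 (hμPi L hL)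
    (hK1 L hL i U₀ ρ hreg (hρ.trans (hαMPi L)) hlift a ha₀a ha₁a)
  have hCQ0 : 0 ≤ (2 * (Real.sqrt 2 * (2 * Real.exp ((159 * ((((3 : ℕ) + 2) * L : ℕ) : ℝ) * (2 * ((3 : ℕ) : ℝ))) / (((L : ℝ) ^ (3 : ℕ))⁻¹ * (L : ℝ)) * (((((3 : ℕ) + 2) * L : ℕ) : ℝ) ^ 2 / 16 * αM L)) + 1))
            * (cB L / c₀ L) * ((L : ℝ) ^ (i.1.2.2 - i.1.2.1))⁻¹ ^ 3) := by positivity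
  have main := gradient_row_HT_of_gradient_row U₀ _ hp₁ hCQ0 hG hQ hK b
  refine main.trans (mul_le_mul_of_nonneg_right (le_of_eq ?_) (norm_nonneg _))
  -- the K-free product: `(cB∕c₀)ℓ⁻³ · (c₀∕cB)ℓ³ = 1`
  have hℓ : (L : ℝ) ^ (i.1.2.2 - i.1.2.1) ≠ 0 := pow_ne_zero _ hL0.ne'
  field_simp

/-! ## §2 ★★★ S47's row `norm_H₁` for all members, modulo `hqG` -/

/-- ★★★ **THE S47 ROW `norm_H₁` FOR ALL MEMBERS AS ONE `∃`-PACKAGE — NO ROOM — MODULO `hqG` (the ROOM-FREE row (6) socket)** (R-edition of ✓`normHone_family_exists`) — px21's member door ✓`norm_H1f_le_of_kernelRow_of_gradLetter` at the J-slot of every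
member over px12's K6-H1 package ✓`hH1kernel_family_exists` (the value half) and §1's gradient family (the ∇-half); `B₀ L := max (3·CH L·(2(1+1∕(δH L∕2)))³) (MG L)`; antecedents =
✓`hH1kernel_family_exists_allMembers`' VERBATIM (`RegPr`, cap, `Lift`, coupling window — NO ROOM).
[cite: Balaban1985BackgroundPropagators, (3.126)–(3.129) pp.420–421, (3.138) p.423, Thm 3.13 p.426; Balaban1985Variational, Thm 1 p.279, (103) p.293, (115)–(117) pp.294–295] -/
theorem normHone_family_exists_allMembers (c₀ cB : ℕ → ℝ) [hc₀ : ∀ L : ℕ, Fact (0 < c₀ L)] [hcB : ∀ L : ℕ, Fact (0 < cB L)] {a₀ a₁ : ℝ} (ha₀ : 0 < a₀) (ha₀₁ : a₀ ≤ a₁)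
    (αq qG : ℕ → ℝ) (hαq : ∀ L : ℕ, 1 < L → 0 < αq L) (hqG : ∀ L : ℕ, 1 < L → 0 ≤ qG L)
    (hqGrow : ∀ (L : ℕ), 1 < L → ∀ (i : Idx L) (U₀ : GaugeField (i.1.1.P i.1.2.2) 0 (Matrix.specialUnitaryGroup (Fin 2) ℂ)), RegPr i.1.1 i.1.2.1 i.1.2.2 (αq L) U₀ →
      ∀ (X' : PBond (i.1.1.P i.1.2.2) 0 → Matrix (Fin 2) (Fin 2) ℂ) (s : ℝ) (x : Site (i.1.1.P i.1.2.2) 0) (A : Matrix (Fin 2) (Fin 2) ℂ), (∀ b, ‖X' b‖ ≤ s) →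
        ∑ y : PBond (i.1.1.P i.1.2.1) 0, ‖avgHess i.1.1 i.1.2.1 i.1.2.2 i.2.2.le U₀ X'
            ((toL2 i.1.1 i.1.2.2 (c₀ L)).symm (DL2 i.1.1 i.1.2.1 i.1.2.2 (c₀ L) U₀ (toL2S i.1.1 i.1.2.2 (c₀ L) (Pi.single x A)))) y‖
          ≤ qG L * ((L : ℝ) ^ (i.1.2.2 - i.1.2.1))⁻¹ * s * ‖A‖) :
    ∃ (αN B₀ : ℕ → ℝ),
      (∀ L : ℕ, 1 < L → 0 < αN L) ∧ (∀ L : ℕ, 1 < L → 10 ^ 12 * (L : ℝ) ^ 3 * αN L ≤ 1) ∧ (∀ L : ℕ, 1 < L → 10 ^ 10 * (L : ℝ) ^ 6 * αN L ≤ 1) ∧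
      (∀ L : ℕ, 1 < L → 13 * 10 ^ 14 * (L : ℝ) ^ 3 * αN L ≤ 1) ∧ (∀ L : ℕ, 1 < L → αN L ≤ αq L) ∧ (∀ L : ℕ, 1 < L → αN L ≤ 1) ∧ (∀ L : ℕ, 1 < L → 0 ≤ B₀ L) ∧
    ∀ (L : ℕ), 1 < L → ∀ (i : Idx L) (U₀ : GaugeField (i.1.1.P i.1.2.2) 0 (Matrix.specialUnitaryGroup (Fin 2) ℂ)), ∀ ρ : ℝ, RegPr i.1.1 i.1.2.1 i.1.2.2 ρ U₀ → ρ ≤ αN L →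
        (∀ cf : Site (i.1.1.P i.1.2.2) (i.1.2.2 - i.1.2.1) → Matrix (Fin 2) (Fin 2) ℂ,
        (∀ e' : PBond (i.1.1.P i.1.2.2) (i.1.2.2 - i.1.2.1), cf e'.src = ((emlIterU (i.1.2.2 - i.1.2.1) (bgUnits i.1.1 i.1.2.2 U₀) e' : (Matrix (Fin 2) (Fin 2) ℂ)ˣ) : Matrix (Fin 2) (Fin 2) ℂ) * cf e'.tgt *
        (((emlIterU (i.1.2.2 - i.1.2.1) (bgUnits i.1.1 i.1.2.2 U₀) e')⁻¹ : (Matrix (Fin 2) (Fin 2) ℂ)ˣ) : Matrix (Fin 2) (Fin 2) ℂ)) →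
        ∃ l₀ : Site (i.1.1.P i.1.2.2) 0 → Matrix (Fin 2) (Fin 2) ℂ,
        (∀ b' : PBond (i.1.1.P i.1.2.2) 0, l₀ b'.src = ((bgUnits i.1.1 i.1.2.2 U₀ b' : (Matrix (Fin 2) (Fin 2) ℂ)ˣ) : Matrix (Fin 2) (Fin 2) ℂ) * l₀ b'.tgt * (((bgUnits i.1.1 i.1.2.2 U₀ b')⁻¹ : (Matrix (Fin 2) (Fin 2) ℂ)ˣ) : Matrix (Fin 2) (Fin 2) ℂ)) ∧
        ∀ y : Site (i.1.1.P i.1.2.2) (i.1.2.2 - i.1.2.1), l₀ (embIter (i.1.2.2 - i.1.2.1) y) = cf y) →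
      ∀ a : ℝ, a₀ * (c₀ L / cB L) * ((i.1.1.L : ℝ) ^ (i.1.2.2 - i.1.2.1)) ^ 3 ≤ a → a ≤ a₁ * (c₀ L / cB L) * ((i.1.1.L : ℝ) ^ (i.1.2.2 - i.1.2.1)) ^ 3 →
      ∀ b, ‖H1f i.1.1 i.1.2.1 i.1.2.2 i.2.2.le (c₀ L) (cB L) a (DeltaOnePJ i.1.1 i.1.2.1 i.1.2.2 i.2.2.le (c₀ L) (cB L) a) U₀ b‖ ≤ B₀ L * ‖b‖ := by
  classical
  obtain ⟨αH, CH, δH, hαH, hWH12, hWH10, hWH13, hαH1, hCH, hδH, hk⟩ := hH1kernel_family_exists_allMembers c₀ cB ha₀ ha₀₁ αq qG hαq hqG hqGrow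
  obtain ⟨αG, MG, hαG, hWG12, hWG10, hWG13, hαGq, hαG1, hMG, hGone⟩ := hGone_family_exists_allMembers c₀ cB ha₀ ha₀₁ αq qG hαq hqG hqGrow
  set αN : ℕ → ℝ := fun L => min (αH L) (αG L) with hαN
  have hαN0 : ∀ L : ℕ, 1 < L → 0 < αN L := fun L hL => lt_min (hαH L hL) (hαG L hL)
  refine ⟨αN, fun L => max (3 * CH L * (2 * (1 + 1 / (δH L / 2))) ^ 3) (MG L), hαN0, fun L hL => ?_, fun L hL => ?_, fun L hL => ?_,
    fun L hL => (min_le_right _ _).trans (hαGq L hL), fun L hL => (min_le_left _ _).trans (hαH1 L hL), fun L hL => le_max_of_le_right (hMG L hL), ?_⟩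
  · exact (mul_le_mul_of_nonneg_left (min_le_left _ _) (by positivity)).trans (hWH12 L hL)
  · exact (mul_le_mul_of_nonneg_left (min_le_left _ _) (by positivity)).trans (hWH10 L hL)
  · exact (mul_le_mul_of_nonneg_left (min_le_left _ _) (by positivity)).trans (hWH13 L hL)
  intro L hL i U₀ ρ hreg hρ hlift a ha₀a ha₁a b
  rw [DeltaOnePJ_def]
  have hδ2 : 0 < δH L / 2 := half_pos (hδH L hL)
  haveI : Fact (0 < (i.1.1.L : ℝ)) := hFL i.1.1
  haveI : Fact (0 < ((i.1.1.L : ℝ)⁻¹) ^ (i.1.2.2 - i.1.2.1)) := hFη i.1.1 _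
  refine norm_H1f_le_of_kernelRow_of_gradLetter i.1.1 i.1.2.1 i.1.2.2 i.2.2.le (c₀ L) (cB L) a
    (DeltaOneP i.1.1 i.1.2.1 i.1.2.2 i.2.2.le (c₀ L) (cB L) a (TJSlotP i.1.1 i.1.2.1 i.1.2.2 i.2.2.le (c₀ L) (cB L) a)) U₀ (hCH L hL) hδ2 (fun y Z bd => ?_)
    (hGone L hL i U₀ ρ hreg (hρ.trans (min_le_right _ _)) hlift a ha₀a ha₁a) b
  have h := hk L hL i U₀ ρ hreg (hρ.trans (min_le_left _ _)) hlift a ha₀a ha₁a y Z (bondEquiv i.1.1 i.1.2.2 bd)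
  rwa [flat115_H1f_apply, Equiv.symm_apply_apply] at h

end Summit.QuantumFields.YangMills.Theorems.Prop7NormHoneFamilyPackageAllMembers

end
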